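import Mathlib
import HarnessLib
import Literature.Analysis.FluidPDE.VectorCalculus
import Literature.Analysis.FluidPDE.VorticityCalculus
import Literature.Analysis.FluidPDE.TaoEnstrophyLocalisation

/-!
# Route `UnthreadedDoor` / `ThreadingFlux`, crux `PoloidalLiouville` (stmt-NavierStokesRegularity-1222), antidynamo v2 skeleton
# (sha16 `4ebf5683127b`), rung `stub_singleDegreeRung` (BC5): ANALYTIC CONTINUATION OF THE SINGLE-DEGREE VORTICITY FORM
# (census step S2(b), third brick)

Support file (seat leafhand-ns-unthreadeddoor-1 g0, cell decomp-ns), `--supports stmt-NavierStokesRegularity-1222 --as helper`; theorems only.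
Continues `…AntidynamoSpherePathCoefficient` (p795123) and `…AntidynamoChunkVorticity`: those give the single-degree vorticity form
`curl v = ĝ(‖y‖) • Λ(y)` on a small open CHUNK (where the rung's potential is differentiable).  Here the form is propagated to the whole
punctured space when the slice is REAL-ANALYTIC (which the rung's class provides through the tree's
`PoloidalLiouville.NetFlux.nsSpatialAnalyticity`):

* ★ `curl_eq_smul_of_eqOn_chunk` — let `v, Λ : ℝ³ → ℝ³` be `C^ω`, `θ₁` a unit vector with `Λ(r θ₁) ≠ 0` for `r > 0`, and `O` an open
  nonempty set avoiding the origin, closed under `y ↦ ‖y‖ θ₁` (it contains the ray points of its radii), on which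
  `curl v = ĝ(‖·‖) • Λ` for SOME function `ĝ`.  Then with the ANALYTIC coefficient `ĝₐ(r) := ⟪curl v(rθ₁), Λ(rθ₁)⟫/‖Λ(rθ₁)‖²` one has
  `curl v z = ĝₐ(‖z‖) • Λ z` for EVERY `z ≠ 0` (identity theorem on the connected set `ℝ³ ∖ {0}` for the `C^ω` field
  `curl v − ĝₐ(‖·‖) • Λ`, which vanishes on `O`), and `ĝₐ` is `C^ω` on `(0, ∞)`.

HONEST LABEL: a continuation brick for the plan-only rung; nothing here proves the rung, the wall, `PoloidalLiouville` (1222) or bears on NS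
regularity.  [folklore]
-/

noncomputable section

-- the summit and its single sub-problem share the name (CONVENTIONS §1)
set_option linter.dupNamespace false

open scoped Topology InnerProductSpace RealInnerProductSpace ContDiff
open Filter Set Function Metric
open Literature.Analysis.FluidPDE

namespace Summit.NavierStokesRegularity.NavierStokesRegularity.Theorems.PoloidalLiouville.Antidynamo

/-- `curl` of a `C^ω` field is `C^ω`. [folklore] -/
theorem contDiff_omega_curl {v : EuclideanSpace ℝ (Fin 3) → EuclideanSpace ℝ (Fin 3)} (hv : ContDiff ℝ ω v) :
    ContDiff ℝ ω (curl v) := by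
  rw [curl_eq_curlCLM_comp]
  exact curlCLM.contDiff.comp (hv.fderiv_right le_rfl)

/-- ★ ANALYTIC CONTINUATION OF THE SINGLE-DEGREE VORTICITY FORM from a chunk to the punctured space. [folklore] -/
theorem curl_eq_smul_of_eqOn_chunk
    {v Λ : EuclideanSpace ℝ (Fin 3) → EuclideanSpace ℝ (Fin 3)} (hv : ContDiff ℝ ω v) (hΛ : ContDiff ℝ ω Λ)
    {θ₁ : EuclideanSpace ℝ (Fin 3)} (hθ₁ : ‖θ₁‖ = 1) (hΛθ : ∀ r : ℝ, 0 < r → Λ (r • θ₁) ≠ 0)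
    {O : Set (EuclideanSpace ℝ (Fin 3))} (hO : IsOpen O) (hOne : O.Nonempty) (hO0 : ∀ y ∈ O, y ≠ 0)
    (hray : ∀ y ∈ O, ‖y‖ • θ₁ ∈ O)
    {ĝ : ℝ → ℝ} (hform : ∀ y ∈ O, curl v y = ĝ ‖y‖ • Λ y) :
    (ContDiffOn ℝ ω (fun r : ℝ => ⟪curl v (r • θ₁), Λ (r • θ₁)⟫ / ‖Λ (r • θ₁)‖ ^ 2) (Ioi 0)) ∧
    ∀ z : EuclideanSpace ℝ (Fin 3), z ≠ 0 →
      curl v z = (⟪curl v (‖z‖ • θ₁), Λ (‖z‖ • θ₁)⟫ / ‖Λ (‖z‖ • θ₁)‖ ^ 2) • Λ z := by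
  set ga : ℝ → ℝ := fun r => ⟪curl v (r • θ₁), Λ (r • θ₁)⟫ / ‖Λ (r • θ₁)‖ ^ 2 with hga
  have hcv : ContDiff ℝ ω (curl v) := contDiff_omega_curl hv
  -- `ga` is `C^ω` on `(0, ∞)`
  have hga_at : ∀ r : ℝ, 0 < r → ContDiffAt ℝ ω ga r := by
    intro r hr
    have hline : ContDiff ℝ ω (fun s : ℝ => s • θ₁) := contDiff_id.smul contDiff_const
    have hnum : ContDiffAt ℝ ω (fun s : ℝ => ⟪curl v (s • θ₁), Λ (s • θ₁)⟫) r :=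
      ((hcv.comp hline).contDiffAt).inner ℝ ((hΛ.comp hline).contDiffAt)
    have hden : ContDiffAt ℝ ω (fun s : ℝ => ‖Λ (s • θ₁)‖ ^ 2) r := ((hΛ.comp hline).contDiffAt).norm_sq ℝ
    exact hnum.div hden (pow_ne_zero _ (norm_ne_zero_iff.2 (hΛθ r hr)))
  refine ⟨fun r hr => (hga_at r hr).contDiffWithinAt, ?_⟩
  -- on `O`, `ga ‖y‖ = ĝ ‖y‖`
  have hgaO : ∀ y ∈ O, ga ‖y‖ = ĝ ‖y‖ := by
    intro y hy
    have hy0 : 0 < ‖y‖ := norm_pos_iff.2 (hO0 y hy)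
    have h1 := hform _ (hray y hy)
    have hn : ‖‖y‖ • θ₁‖ = ‖y‖ := by rw [norm_smul, norm_norm, hθ₁, mul_one]
    rw [hn] at h1
    have hne : ‖Λ (‖y‖ • θ₁)‖ ^ 2 ≠ 0 := pow_ne_zero _ (norm_ne_zero_iff.2 (hΛθ _ hy0))
    simp only [hga]
    rw [h1, inner_smul_left, real_inner_self_eq_norm_sq]
    simp only [RCLike.conj_to_real]
    exact mul_div_cancel_right₀ _ hne
  -- the difference field is `C^ω` on `{0}ᶜ` and vanishes on `O`
  set E : EuclideanSpace ℝ (Fin 3) → EuclideanSpace ℝ (Fin 3) := fun z => curl v z - ga ‖z‖ • Λ z with hE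
  have hEan : AnalyticOnNhd ℝ E ({0}ᶜ : Set (EuclideanSpace ℝ (Fin 3))) := by
    intro z hz
    have hz' : z ≠ 0 := hz
    have hz0 : 0 < ‖z‖ := norm_pos_iff.2 hz'
    have h1 : ContDiffAt ℝ ω (fun w : EuclideanSpace ℝ (Fin 3) => ga ‖w‖) z :=
      (hga_at ‖z‖ hz0).comp z (contDiffAt_norm ℝ hz')
    have h2 : ContDiffAt ℝ ω E z := hcv.contDiffAt.sub (h1.smul hΛ.contDiffAt)
    exact h2.analyticAt
  have hpre : IsPreconnected ({0}ᶜ : Set (EuclideanSpace ℝ (Fin 3))) := by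
    have hrank : 1 < Module.rank ℝ (EuclideanSpace ℝ (Fin 3)) := by
      rw [← Module.finrank_eq_rank, finrank_euclideanSpace_fin]
      norm_num
    exact (isConnected_compl_singleton_of_one_lt_rank hrank 0).isPreconnected
  obtain ⟨z₀, hz₀⟩ := hOne
  have hEz : E =ᶠ[𝓝 z₀] 0 := by
    filter_upwards [hO.mem_nhds hz₀] with y hy
    simp only [hE, Pi.zero_apply, hform y hy, hgaO y hy, sub_self]
  have hzero := hEan.eqOn_zero_of_preconnected_of_eventuallyEq_zero hpre (hO0 z₀ hz₀) hEz
  intro z hz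
  have := hzero (show z ∈ ({0}ᶜ : Set (EuclideanSpace ℝ (Fin 3))) from hz)
  simp only [hE, Pi.zero_apply, sub_eq_zero] at this
  exact this

end Summit.NavierStokesRegularity.NavierStokesRegularity.Theorems.PoloidalLiouville.Antidynamo

end
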